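import Summits.BirchSwinnertonDyer.BirchSwinnertonDyer.Theorems.InertBadSignedBranchesInertBadAtThreeIstarZeroWitness484416bw1
import Literature.NumberTheory.EllipticCurves.Rank1Residual.Typed.CasselsLowerBound
import HarnessLib

/-!
# Route `InertBadSignedBranches` (rung K8), D71 child `InertBadAtThreeIstarZero` (stmt-BirchSwinnertonDyer-19656):
# a member of the type `(3, I₀*)` BEYOND the census at which the child's OPEN half is NON-VACUOUS —
# `E_A = [0, 0, 0, 23742, 0]` (`A = 9·(2638)`, `j = 1728`, `#Ш_an = 9`) — and the lower half
# `MissingLowerBoundAt W 3` at it from two displayed data (helper `--supports` 19656; cell `bsd-cm`,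
# seat `bsd-cm-k8i-c41` g4; nothing asserted)

HONEST FRAMING (cell `bsd-cm`, run/shared/lean/pub/bsd-cm/): Birch–Swinnerton-Dyer is NOT proved by any
of this; the item `InertBadAtThreeIstarZero` (= `BSD₃` on the type, class level) is OPEN and stays so.
Modulo published facts the item is the conjecture node `X12.O10.LowerHalfOnType 3 (.Istar 0)`: for every
rank-one `W` of signed type `(3, I₀*)`, `MissingLowerBoundAt W 3` («`ord₃ #Ш_an ≤ ord₃ #Ш`»). On ALL 57
census classes (`N < 5·10⁵`, x1b T-KR3-154) `#Ш_an = 1`, so that half had never been observed with content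
on the child's own corner. This file is the per-pair RECORD (x1b T-KR@3 / this seat's `7200bg1`, `441d1`,
`484416bw1` style) of the first such member found by the seat's census beyond Cremona (kit j253278: the
`j = 1728` part `E_A : y² = x³ + Ax`, `A = 9A′`, `|A′| ≤ 10⁴`, of the type) and certified by k8i-c42's
`3`-descent engine (kit/sel3, Schaefer–Stoll descent in the octic field `ℚ(E[3])⁺`; job id in the evidence
file PS3-SCAN-19656.md on the item): `dim_𝔽₃ Sel₃(E_A/ℚ) = 3` with the Mordell–Weil line inside, i.e.
`Ш(E_A/ℚ)[3] ≅ (ℤ/3)²`, matching `#Ш_an = 9`.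
* §1 the model: `Δ = −64·A³`, `j = 1728`, global minimality (Kraus, kernel-decided), bad at `3`, Kodaira
  `I₀*` at the place over `3` (the `3`-twist of `[0, 0, 0, 2638, 0]`, whose discriminant is a `3`-unit —
  x1b's `kodairaSymbolAt_twist_of_valuation_eq`), hence `HasSignedLocalType W 3 (.Istar 0)` — UNCONDITIONAL.
* §2 the LOWER HALF at the member: `MissingLowerBoundAt W 3` (squareness-free bookkeeping, the shape of
  k8i-c42's `InertBadOffDescentRecords` for the III corner) from the displayed data `9 ∣ #Ш(W)` (the
  certified `(ℤ/3)² ↪ Ш`, entered as a divisibility or as an injection `(Fin 2 → ZMod 3) →+ Ш`) and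
  `#Ш_an = q` with `ord₃ q ≤ 2` (certified numerics `#Ш_an = 9.00000000`), `Ш` finite from GZK at `r_an = 1`.
  What is NOT recorded: the upper half at the member (`Ш[3^∞] = Ш[3]` would need a `9`-descent / the
  Cassels–Tate pairing on `Sel₃`, or the Manin input of the Kolyvagin side at conductor `> 3·10⁵`).
THEOREMS ONLY: 0 definitions, 0 named facts minted, 0 `sorry`; every datum is a displayed hypothesis.

PARTITION (D-0054): CornerF inert-bad (B12 / O10) × the pair (`E_23742`, `3`), type `(3, I₀*)`, `d_K = −4`,
beyond the `N < 5·10⁵` census × `p = 3` — types-the-object-of (membership UNCONDITIONAL; lower half at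
the member CONDITIONAL on two certified data + GZK); closes no cell, books nothing, moves no mark.

References (locators only): [SilvermanATAEC1994] IV.9.4 Step 6, Table 4.1; [SilvermanAEC2009] VII.1
Remark 1.1, VII.5 Prop. 5.1(a), X.4; [Kraus1989] Prop. 1–2; [Miller2011LMS] §1, Def. 1.1;
[SchaeferStoll2004] (the descent method of the certificate).
-/

set_option autoImplicit false
set_option linter.dupNamespace false

noncomputable section

open scoped Classical NumberField

open WeierstrassCurve NumberField IsDedekindDomain IsDedekindDomain.HeightOneSpectrum
  Rat.HeightOneSpectrum
open Literature.NumberTheory.EllipticCurves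
open Literature.NumberTheory.GaloisRepresentations
open Literature.NumberTheory.EllipticCurves.ModularForms
open Literature.NumberTheory.EllipticCurves.Rank1Residual
open Literature.NumberTheory.EllipticCurves.Rank1Residual.Typed
open Summit.BirchSwinnertonDyer.Rank1Residual
open Summit.BirchSwinnertonDyer.Rank1Residual.X12
open Summit.BirchSwinnertonDyer.Rank1Residual.X12.O10
open Summit.BirchSwinnertonDyer.BirchSwinnertonDyer.Rank1Residual.X11RankOne

namespace Summit.BirchSwinnertonDyer.BirchSwinnertonDyer.Theorems.InertBadAtThreeWitness

/-! ## §1 The model `E_A = [0, 0, 0, 23742, 0]` — UNCONDITIONAL facts -/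

/-- `Δ([0,0,0,23742,0]) = −64·23742³ = -856508891807232`. [cite: SilvermanAEC2009, III.1] -/
theorem Δ_of_eq_a23742 (W : WeierstrassCurve ℚ) (hW : W = ⟨((0 : ℤ) : ℚ), ((0 : ℤ) : ℚ), ((0 : ℤ) : ℚ), ((23742 : ℤ) : ℚ), ((0 : ℤ) : ℚ)⟩) :
    W.Δ = -856508891807232 := by
  subst hW
  norm_num [WeierstrassCurve.Δ, WeierstrassCurve.b₂, WeierstrassCurve.b₄, WeierstrassCurve.b₆,
    WeierstrassCurve.b₈]

/-- `j([0,0,0,23742,0]) = 1728` (`c₆ = 0`). [cite: SilvermanAEC2009, III.1] -/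
theorem j_of_eq_a23742 (W : WeierstrassCurve ℚ) [W.IsElliptic] (hW : W = ⟨((0 : ℤ) : ℚ), ((0 : ℤ) : ℚ), ((0 : ℤ) : ℚ), ((23742 : ℤ) : ℚ), ((0 : ℤ) : ℚ)⟩) :
    W.j = 1728 := by
  have hΔ := Δ_of_eq_a23742 W hW
  have hc₄ : W.c₄ = -1139616 := by
    subst hW; norm_num [WeierstrassCurve.c₄, WeierstrassCurve.b₂, WeierstrassCurve.b₄]
  rw [j, Units.inv_mul_eq_iff_eq_mul, hc₄, coe_Δ', hΔ]
  norm_num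

set_option maxRecDepth 100000 in
/-- `[0, 0, 0, 23742, 0]` is globally minimal (`A` fourth-power-free: `q¹² ∤ Δ = −2⁶A³` or `q⁴ ∤ c₄ = −48A`
for every prime `q`; Kraus' bounded criterion, kernel-decided). [cite: SilvermanAEC2009, VII.1 Remark 1.1 and VIII.8] [cite: Kraus1989, Prop. 1 and Prop. 2] -/
theorem isGloballyMinimal_of_eq_a23742 (W : WeierstrassCurve ℚ) (hW : W = ⟨((0 : ℤ) : ℚ), ((0 : ℤ) : ℚ), ((0 : ℤ) : ℚ), ((23742 : ℤ) : ℚ), ((0 : ℤ) : ℚ)⟩) :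
    W.IsGloballyMinimal := by
  subst hW
  exact isGloballyMinimal_of_krausCriterion_bounded 0 0 0 (23742) 0 (by decide) (by decide) (by decide +kernel)

/-- `E_23742` is BAD at `3` (`3 ∣ Δ_min`). [cite: SilvermanAEC2009, VII.5 Prop. 5.1(a)] -/
theorem not_good_three_of_eq_a23742 (W : WeierstrassCurve ℚ) [Fact (Nat.Prime 3)] (hW : W = ⟨((0 : ℤ) : ℚ), ((0 : ℤ) : ℚ), ((0 : ℤ) : ℚ), ((23742 : ℤ) : ℚ), ((0 : ℤ) : ℚ)⟩) :
    ¬ Good W 3 := by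
  haveI := isGloballyMinimal_of_eq_a23742 W hW
  refine not_hasGoodReductionAtPrime_of_dvd_minimalDiscriminantInt W 3 ?_
  have h : (minimalDiscriminantInt W : ℚ) = ((-856508891807232 : ℤ) : ℚ) := by
    rw [cast_minimalDiscriminantInt, Δ_of_eq_a23742 W hW]; norm_num
  rw [Int.cast_inj.mp h]
  norm_num

/-- **Kodaira type `I₀*` at the place over `3`**: `[0,0,0,23742,0]` is the quadratic twist by `3` of
`[0,0,0,2638,0]` (`Δ₀ = -1174909316608`, a `3`-unit; `v₃(3) = 1`) — Tate's algorithm Step 6 via x1b's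
`kodairaSymbolAt_twist_of_valuation_eq`. UNCONDITIONAL. [cite: SilvermanATAEC1994, IV.9.4 Step 6 and Table 4.1] -/
theorem kodairaSymbolAt_three_of_eq_a23742 (W : WeierstrassCurve ℚ) [W.IsElliptic] (hW : W = ⟨((0 : ℤ) : ℚ), ((0 : ℤ) : ℚ), ((0 : ℤ) : ℚ), ((23742 : ℤ) : ℚ), ((0 : ℤ) : ℚ)⟩)
    (v : HeightOneSpectrum (𝓞 ℚ)) (hv : natGenerator v = 3) : W.kodairaSymbolAt v = .Istar 0 := by
  have hv2 : natGenerator v ≠ 2 := by rw [hv]; decide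
  set E₀ : WeierstrassCurve ℚ := ⟨0, 0, 0, 2638, 0⟩ with hE₀
  haveI : E₀.IsElliptic := by
    rw [hE₀, show (⟨0, 0, 0, 2638, 0⟩ : WeierstrassCurve ℚ) =
      ⟨((0 : ℤ) : ℚ), ((0 : ℤ) : ℚ), ((0 : ℤ) : ℚ), ((2638 : ℤ) : ℚ), ((0 : ℤ) : ℚ)⟩ by norm_num]
    exact Summit.BirchSwinnertonDyer.Rank1Residual.X11b.isElliptic_of_discOf_ne_zero 0 0 0 (2638) 0 (by decide)
  have hb₂ : v.valuation ℚ E₀.b₂ ≤ 1 := by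
    rw [show E₀.b₂ = ((0 : ℤ) : ℚ) by norm_num [hE₀, WeierstrassCurve.b₂]]
    exact valuation_ringOfIntegers_intCast_le_one v _
  have hb₄ : v.valuation ℚ E₀.b₄ ≤ 1 := by
    rw [show E₀.b₄ = ((5276 : ℤ) : ℚ) by norm_num [hE₀, WeierstrassCurve.b₄]]
    exact valuation_ringOfIntegers_intCast_le_one v _
  have hb₆ : v.valuation ℚ E₀.b₆ ≤ 1 := by
    rw [show E₀.b₆ = ((0 : ℤ) : ℚ) by norm_num [hE₀, WeierstrassCurve.b₆]]
    exact valuation_ringOfIntegers_intCast_le_one v _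
  have hΔ₀ : v.valuation ℚ E₀.Δ = 1 := by
    rw [show E₀.Δ = ((-1174909316608 : ℤ) : ℚ) by
      norm_num [hE₀, WeierstrassCurve.Δ, WeierstrassCurve.b₂, WeierstrassCurve.b₄,
        WeierstrassCurve.b₆, WeierstrassCurve.b₈]]
    refine Rat.valuation_intCast_eq_one v ?_
    rw [hv]
    intro h
    have h' : (3 : ℤ) ∣ (-1174909316608 : ℤ) := by exact_mod_cast h
    omega
  have hpv : ((primesEquiv v : ℕ) : ℤ) = 3 := by
    rw [show (primesEquiv v : ℕ) = natGenerator v from rfl, hv]; rfl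
  have h1 : ((primesEquiv v : ℕ) : ℤ) ∣ (3 : ℤ) := by rw [hpv]
  have h2 : ¬ ((primesEquiv v : ℕ) : ℤ) ^ 2 ∣ (3 : ℤ) := by rw [hpv]; norm_num
  have hnv : v.valuation ℚ (((3 : ℤ) : ℚ)) = WithZero.exp (-1 : ℤ) :=
    valuation_ringOfIntegers_intCast_eq_exp_neg_one v h1 h2
  have hnv' : v.valuation ℚ (3 : ℚ) = WithZero.exp (-1 : ℤ) := by exact_mod_cast hnv
  have hM : E₀.quadraticTwist (3 : ℚ) = (1 : VariableChange ℚ) • W := by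
    rw [one_smul, hW]
    ext <;> norm_num [hE₀, quadraticTwist, WeierstrassCurve.b₂, WeierstrassCurve.b₄, WeierstrassCurve.b₆]
  exact kodairaSymbolAt_twist_of_valuation_eq W v hv2 E₀ hb₂ hb₄ hb₆ hΔ₀ hnv' 1 hM

/-- **`E_23742` has signed local type `(3, I₀*)`** — CM by `ℤ[i]` (`j = 1728`), `3` INERT in `ℚ(i)`, bad at
`3`, Kodaira `I₀*` at the place over `3`. UNCONDITIONAL (kernel) for any model equal to `[0,0,0,23742,0]`;
a member of the type BEYOND the `N < 5·10⁵` census. [cite: SilvermanATAEC1994, IV.9.4, Table 4.1 and App. A §3] -/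
theorem hasSignedLocalType_three_of_eq_a23742 (W : WeierstrassCurve ℚ) [W.IsElliptic] [Fact (Nat.Prime 3)]
    (hW : W = ⟨((0 : ℤ) : ℚ), ((0 : ℤ) : ℚ), ((0 : ℤ) : ℚ), ((23742 : ℤ) : ℚ), ((0 : ℤ) : ℚ)⟩) : HasSignedLocalType W 3 (.Istar 0) :=
  ⟨hasCM_of_j_eq_1728 _ (j_of_eq_a23742 W hW), cmInert_three_of_j_eq_1728 W (j_of_eq_a23742 W hW),
    not_good_three_of_eq_a23742 W hW, fun v hv ↦ kodairaSymbolAt_three_of_eq_a23742 W hW v hv⟩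

/-! ## §2 The OPEN half of the child AT the member — from two certified data -/

/-- **The lower half `MissingLowerBoundAt W 3` at `E_23742`** — the conclusion of the conjecture node
`LowerHalfOnType 3 (.Istar 0)` at this member, NON-VACUOUSLY (`ord₃ #Ш_an = 2`): GIVEN GZK (`hGZK`, for
`Ш` finite at `r_an = 1`), the certified datum `r_an = 1` (`hr`), the certified numerics `#Ш_an = q` with
`ord₃ q ≤ 2` (`hq`, `hv`; `q = 9`), and the certified `3`-descent datum `9 ∣ #Ш(W)` (`hdvd`;
`dim_𝔽₃ Sel₃ = 3`, rank `1`, `W(ℚ)[3] = 0` ⇒ `Ш[3] ≅ (ℤ/3)²`). RELATIVE (per-pair); CONDITIONAL on every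
displayed hypothesis; nothing booked; 19656 stays OPEN at class level. [cite: Miller2011LMS, §1 and Def. 1.1] -/
theorem missingLowerBoundAt_three_of_eq_a23742 (hGZK : rank_eq_analyticRank_of_analyticRank_le_one)
    (W : WeierstrassCurve ℚ) [W.IsElliptic] [Fact (Nat.Prime 3)] (hW : W = ⟨((0 : ℤ) : ℚ), ((0 : ℤ) : ℚ), ((0 : ℤ) : ℚ), ((23742 : ℤ) : ℚ), ((0 : ℤ) : ℚ)⟩)
    (hr : W.analyticRank = 1) {q : ℚ} (hq : shaAn W = (q : ℂ)) (hv : padicValRat 3 q ≤ 2)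
    (hdvd : 3 ^ 2 ∣ W.shaOrder) : HasSignedLocalType W 3 (.Istar 0) ∧ MissingLowerBoundAt W 3 := by
  refine ⟨hasSignedLocalType_three_of_eq_a23742 W hW, q, hq, hv.trans ?_⟩
  have hn : W.shaOrder ≠ 0 := (WeierstrassCurve.shaOrder_pos W (hGZK W (by omega)).2).ne'
  exact_mod_cast (padicValNat_dvd_iff_le hn).1 hdvd

/-- The same with the `(ℤ/3)²` EXHIBITED as an injection into `Ш(W)` (the certificate's own shape).
[cite: Miller2011LMS, §1 and Def. 1.1] -/
theorem missingLowerBoundAt_three_of_eq_a23742_of_injective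
    (hGZK : rank_eq_analyticRank_of_analyticRank_le_one)
    (W : WeierstrassCurve ℚ) [W.IsElliptic] [Fact (Nat.Prime 3)] (hW : W = ⟨((0 : ℤ) : ℚ), ((0 : ℤ) : ℚ), ((0 : ℤ) : ℚ), ((23742 : ℤ) : ℚ), ((0 : ℤ) : ℚ)⟩)
    (hr : W.analyticRank = 1) {q : ℚ} (hq : shaAn W = (q : ℂ)) (hv : padicValRat 3 q ≤ 2)
    (f : (Fin 2 → ZMod 3) →+ W.sha) (hf : Function.Injective f) :
    HasSignedLocalType W 3 (.Istar 0) ∧ MissingLowerBoundAt W 3 :=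
  missingLowerBoundAt_three_of_eq_a23742 hGZK W hW hr hq hv (pow_dvd_shaOrder_of_injective W 3 f hf)

end Summit.BirchSwinnertonDyer.BirchSwinnertonDyer.Theorems.InertBadAtThreeWitness

end
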